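import Literature.NumberTheory.Kottwitz1992.KottwitzTriples
import Mathlib.Data.Nat.Prime.Basic
import HarnessLib

/-!
# Kottwitz 1992, §17 «ℚ̄-isogeny classes within a ℚ-isogeny class» — Lemma 17.1, Lemma 17.2 (pp. 434–436)

Topic `Literature/NumberTheory/Kottwitz1992` (carpet of R. E. Kottwitz, *Points on some Shimura varieties over
finite fields*, J. Amer. Math. Soc. 5 (1992) 373–444 [Kottwitz1992]; held copy `paper:doi-10-2307-2152772`,
file `p00NN` = printed page `372 + NN`; §17 = pdf 62–64 = pp. 434–436). NAMED FACTS ONLY (D-0014): statements,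
no proofs, no `sorry`, no `axiom`, no `instance`, no `notation`. Namespace
`Literature.NumberTheory.Kottwitz1992.IsogenyClasses` (squad TK file map, 2026-09-02).

## The printed setting (p. 434)

«Let `(A, λ, i)` be a `c`-polarized virtual `B`-abelian variety over `k_r` up to isogeny. Let `(A', i')` be a
virtual `B`-abelian variety over `k_r` up to isogeny, and let `λ' : A' → Â'` be a symmetric isogeny commuting with
`B`. We refer to `(A', λ', i')` as a symmetrized virtual `B`-abelian variety over `k_r` up to isogeny. Suppose that
`(A', λ', i')` is ℚ̄-isogenous to `(A, λ, i)` in the sense that there exists a ℚ̄-isogeny `f : A → A'` commuting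
with `B` such that `f*(λ') = dλ` for some `d ∈ ℚ̄^×`. As in §14 we write `M` for `End_B(A)` and `I` for the ℚ-group of
automorphisms of `(A, λ, i)`. Then `τ ↦ f⁻¹ ∘ τ(f)` (`τ ∈ Γ`) is a 1-cocycle of `Γ = Gal(ℚ̄/ℚ)` in `I(ℚ̄)`.»
(Virtual abelian varieties over `k_r` up to isogeny: §10 pp. 402–403; `c`-polarizations: §10 p. 403; the group
`I(R) = {x ∈ M_R | x x^* ∈ R^×}`: §14 p. 419; the three conditions of §14 and the triple `(γ₀; γ, δ)`: §14
pp. 418–422; `ker¹(ℚ, ·)` = the locally trivial classes: §15 p. 423, and p. 436 «locally trivial at all places of ℚ».)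

## What is vendored, and in which vocabulary

Neither Mathlib nor the tree has (a) the isogeny category of virtual `B`-abelian varieties over `k_r`, (b)
non-abelian Galois cohomology `H¹(ℚ, I)` of a reductive ℚ-group as a pointed set (Mathlib's
`groupCohomology.IsMulCocycle₁` is for COMMUTATIVE coefficients only); Kottwitz triples are the posited datum
`KottwitzTripleData` of the squad file ★ `KottwitzTriples` (landed), which this file imports. Following the tree precedent for statements-first carpets over notions
Lean lacks (`Literature/AlgebraicGeometry/Hu2025/Statements/…`: numbered statements as `Prop`-valued PREDICATES on ONE
cited interface structure), this file declares

* `IsogenyClassData D` — ONE posited datum OVER the landed §14 datum `D : KottwitzTripleData`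
  (★ `Literature.NumberTheory.Kottwitz1992.KottwitzTriples`, imported — no §14 notion is re-posited: `D.Obj`,
  `D.GQ/GAfp/GLr`, `D.IsStConj/IsConjAfp/IsSigmaConj`, `D.Iso1/gammaOf/Iso2/deltaOf`, `D.MaxTorus/Emb/IsStarHom/
  gamma0Of`, `D.Assumptions` are used by name), recording exactly the printed data §17 adds: the base `(A, λ, i)`,
  the symmetrized objects, ℚ-isogeny, ℚ̄-isogeny to the base, the pointed sets `H¹(ℚ, I)` and `H¹(ℚ_v, I)` for
  every place `v` of ℚ (index `Option Nat.Primes`, `none` = the real place — Ostrowski), the localisation maps, the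
  class `coh` of the cocycle `τ ↦ f⁻¹τ(f)`, the predicates «`dλ'` is a polarization for some `d ∈ ℚ^×`» / «… a
  `c`-polarization». Every field's docstring quotes the printed definition it stands for;
* `Kottwitz1992_17_1_bijection S`, `Kottwitz1992_17_1_polarization S` — the two sentences of Lemma 17.1;
* `Kottwitz1992_17_2 S` — Lemma 17.2;
  all `def … (S : IsogenyClassData D) : Prop`, i.e. PREDICATES on the datum (no universally quantified interface, no
  `Prop`-valued assumption smuggled into the conclusion).

VACUITY / JUNK audit (CONVENTIONS §4): no field of `IsogenyClassData` is defaulted; the only `Prop`-valued FIELD is `res_one`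
(the localisation maps are maps of POINTED sets — part of the definition of the objects, [cite: Kottwitz1992, §17
p. 435]); the three statements are not decided by unfolding (each relates at least two independent fields:
`coh`/`IsQIsog`, `HasPolMultiple`/`res none`, the three conjugacy relations/`IsQbarIsogBase`+`res`).

## What is NOT here

The proofs (pp. 434–436); the vanishing of `H¹(ℚ, M^×)` and of `H¹(ℚ, 𝔾_m)` used on p. 434; Lemmas 2.8, 2.9, 9.1,
10.7, 10.8 invoked in the proofs (other squad-TK files); a CONCRETE model of `H¹(ℚ, I)` by cocycles (blocked on
non-abelian `H¹` in Mathlib) — `-- TODO(concrete form)` below records it.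

## References

* R. E. Kottwitz, *Points on some Shimura varieties over finite fields*, J. Amer. Math. Soc. 5 (1992) 373–444:
  §17, Lemma 17.1 (p. 434), Lemma 17.2 (p. 435), proof pp. 434–436; §10 pp. 402–403; §14 pp. 418–422; §15 p. 423.
  [Kottwitz1992]
-/

namespace Literature.NumberTheory.Kottwitz1992.IsogenyClasses

open Literature.NumberTheory.Kottwitz1992.KottwitzTriples (KottwitzTripleData)

universe u

/-- **The data of §17 over the §14 datum `D : KottwitzTripleData`** (★ `KottwitzTriples`, imported: the objects
`D.Obj` = `c`-polarized virtual `B`-abelian varieties over `k_r` up to isogeny, the carriers `G(ℚ)`, `G(𝔸_f^p)`,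
`G(L_r)` with stable conjugacy, conjugacy, `σ`-conjugacy, the choices `Iso1`, `Iso2`, `MaxTorus`, `Emb`, `IsStarHom`
producing `(γ₀; γ, δ) = (gamma0Of, gammaOf, deltaOf)`, and `D.Assumptions` = the three conditions of §14). Added
here [cite: Kottwitz1992, §17 p. 434]: the fixed `(A, λ, i)` (`base`), the symmetrized virtual `B`-abelian varieties
`(A', λ', i')` over `k_r` up to isogeny (`SymObj`; a `c`-polarized one is in particular symmetrized, `ofPol`), the
relation «ℚ-isogenous» between them and «ℚ̄-isogenous to `(A, λ, i)`», the pointed Galois-cohomology sets `H¹(ℚ, I)`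
and `H¹(ℚ_v, I)` of the ℚ-group `I = Aut(A, λ, i)`, `I(R) = {x ∈ M_R | x x^* ∈ R^×}` (`M = End_B(A)`,
[cite: Kottwitz1992, §14 p. 419]) at every place `v` of ℚ (`Option Nat.Primes`: `some p` = the prime `p`, `none` =
the real place), the class `coh X h ∈ H¹(ℚ, I)` of the 1-cocycle `τ ↦ f⁻¹ ∘ τ(f)` of a ℚ̄-isogeny `f : A → A'`, and
the two polarization predicates of Lemma 17.1. Datum only: nothing is asserted beyond `res_one`.
-- TODO(concrete form): `H1`, `H1Loc`, `res`, `coh` by non-abelian continuous 1-cocycles of `Gal(ℚ̄/ℚ)` in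
-- `I(ℚ̄)` once Mathlib has non-abelian `H¹`; `SymObj` from the §10 carrier when it lands. -/
structure IsogenyClassData (D : KottwitzTripleData.{u}) : Type (u + 1) where
  /-- The fixed `c`-polarized virtual `B`-abelian variety `(A, λ, i)` of §17 [cite: Kottwitz1992, §17 p. 434]. -/
  base : D.Obj
  /-- The symmetrized virtual `B`-abelian varieties `(A', λ', i')` over `k_r` up to isogeny: `λ' : A' → Â'` a
  symmetric isogeny commuting with `B` [cite: Kottwitz1992, §17 p. 434]. -/
  SymObj : Type u
  /-- A `c`-polarization is in particular a symmetric isogeny commuting with `B`: the symmetrized object underlying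
  a `c`-polarized one [cite: Kottwitz1992, §17 p. 434]. -/
  ofPol : D.Obj → SymObj
  /-- «ℚ-isogenous»: there is a ℚ-isogeny `f : A' → A''` commuting with `B` with `f*(λ'') = dλ'` for some
  `d ∈ ℚ^×` (the relation whose classes Lemma 17.1 counts) [cite: Kottwitz1992, §17 p. 434]. -/
  IsQIsog : SymObj → SymObj → Prop
  /-- «ℚ̄-isogenous to `(A, λ, i)`»: there is a ℚ̄-isogeny `f : A → A'` commuting with `B` such that
  `f*(λ') = dλ` for some `d ∈ ℚ̄^×` [cite: Kottwitz1992, §17 p. 434]. -/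
  IsQbarIsogBase : SymObj → Prop
  /-- The pointed set `H¹(ℚ, I)`, `I = Aut(A, λ, i)` [cite: Kottwitz1992, §17 p. 434; §14 p. 419]. -/
  H1 : Type u
  /-- The distinguished (trivial) class of `H¹(ℚ, I)` [cite: Kottwitz1992, §17 p. 434]. -/
  one : H1
  /-- The pointed sets `H¹(ℚ_v, I)` at the places `v` of ℚ: `some ℓ` ↦ `H¹(ℚ_ℓ, I)`, `none` ↦ `H¹(ℝ, I)`
  [cite: Kottwitz1992, §17 pp. 434–436]. -/
  H1Loc : Option Nat.Primes → Type u
  /-- The trivial class of `H¹(ℚ_v, I)` [cite: Kottwitz1992, §17 p. 435]. -/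
  oneLoc : ∀ v, H1Loc v
  /-- The localisation maps `H¹(ℚ, I) → H¹(ℚ_v, I)` [cite: Kottwitz1992, §17 p. 435]. -/
  res : ∀ v, H1 → H1Loc v
  /-- The localisation maps are maps of pointed sets [cite: Kottwitz1992, §17 p. 435]. -/
  res_one : ∀ v, res v one = oneLoc v
  /-- The class in `H¹(ℚ, I)` of the 1-cocycle `τ ↦ f⁻¹ ∘ τ(f)` of a ℚ̄-isogeny `f : A → A'` witnessing that
  `X = (A', λ', i')` is ℚ̄-isogenous to `(A, λ, i)` («this construction», p. 434; «the element `α ∈ H¹(ℚ, I)`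
  measuring their difference», p. 435) [cite: Kottwitz1992, §17 pp. 434–435]. -/
  coh : ∀ X : SymObj, IsQbarIsogBase X → H1
  /-- «there exists `d ∈ ℚ^×` such that `dλ'` is a polarization» [cite: Kottwitz1992, Lemma 17.1 (p. 434)]. -/
  HasPolMultiple : SymObj → Prop
  /-- «there exists `d ∈ ℚ^×` such that `dλ'` is a `c`-polarization» (same `c` as for `(A, λ, i)`)
  [cite: Kottwitz1992, Lemma 17.1 (p. 434); §10 p. 403]. -/
  HasCPolMultiple : SymObj → Prop

namespace IsogenyClassData

variable {D : KottwitzTripleData.{u}} (S : IsogenyClassData D)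

/-- The subset `ker¹(ℚ, I) ⊆ H¹(ℚ, I)` of classes that are locally trivial at ALL places of ℚ (finite and real)
(«`ker¹(ℚ, I)`», p. 435; «the element `α` is locally trivial at all places of ℚ», p. 436)
[cite: Kottwitz1992, §17 pp. 435–436; §15 p. 423]. -/
def kerOne : Set S.H1 := {α | ∀ v, S.res v α = S.oneLoc v}

/-- **Lemma 17.1, first sentence** [cite: Kottwitz1992, Lemma 17.1 (p. 434)]. «This construction sets up a
bijection from the set of ℚ-isogeny classes of triples `(A', λ', i')` that are ℚ̄-isogenous to `(A, λ, i)` to the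
set `H¹(ℚ, I)`.» Typed on the interface as: the class `coh` is constant on ℚ-isogeny classes (well-defined),
separates ℚ-isogeny classes (injective on classes), and attains every element of `H¹(ℚ, I)` (surjective). -/
def Kottwitz1992_17_1_bijection : Prop :=
  (∀ (X Y : S.SymObj) (hX : S.IsQbarIsogBase X) (hY : S.IsQbarIsogBase Y),
      S.IsQIsog X Y → S.coh X hX = S.coh Y hY) ∧
  (∀ (X Y : S.SymObj) (hX : S.IsQbarIsogBase X) (hY : S.IsQbarIsogBase Y),
      S.coh X hX = S.coh Y hY → S.IsQIsog X Y) ∧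
  (∀ α : S.H1, ∃ (X : S.SymObj) (hX : S.IsQbarIsogBase X), S.coh X hX = α)

/-- **Lemma 17.1, second sentence** [cite: Kottwitz1992, Lemma 17.1 (p. 434)]. «Moreover, there exists
`d ∈ ℚ^×` such that `dλ'` is a polarization if and only if the corresponding element of `H¹(ℚ, I)` has trivial
image in `H¹(ℝ, I)`, in which case `dλ'` is necessarily a `c`-polarization.» (`none` = the real place.) -/
def Kottwitz1992_17_1_polarization : Prop :=
  ∀ (X : S.SymObj) (hX : S.IsQbarIsogBase X),
    (S.HasPolMultiple X ↔ S.res none (S.coh X hX) = S.oneLoc none) ∧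
    (S.HasPolMultiple X → S.HasCPolMultiple X)

/-- **Lemma 17.2** [cite: Kottwitz1992, Lemma 17.2 (p. 435)]. «Let `(A, λ, i)`, `(A', λ', i')` be two
`c`-polarized virtual `B`-abelian varieties over `k_r` up to isogeny, and suppose that they both satisfy the
three conditions of §14, so that we obtain triples `(γ₀; γ, δ)`, `(γ₀'; γ', δ')` from `(A, λ, i)`, `(A', λ', i')`
respectively. Then the triples `(γ₀; γ, δ)` and `(γ₀'; γ', δ')` are equivalent (that is, `γ₀, γ₀'` are stably
conjugate; `γ, γ'` are conjugate; `δ, δ'` are `σ`-conjugate) if and only if `(A', λ', i')` is ℚ̄-isogenous to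
`(A, λ, i)` and the element `α ∈ H¹(ℚ, I)` measuring their difference lies in `ker¹(ℚ, I)`.» Typed with
`(A, λ, i) = S.base`, `(A', λ', i') = X`, for every choice of the isomorphisms and `*`-embeddings producing the
triples (§14; their classes do not depend on the choices, squad file `KottwitzTriples`). -/
def Kottwitz1992_17_2 : Prop :=
  ∀ X : D.Obj, D.Assumptions S.base → D.Assumptions X →
    ∀ (T : D.MaxTorus S.base) (e : D.Emb S.base T) (e₁ : D.Iso1 S.base) (e₂ : D.Iso2 S.base)
      (T' : D.MaxTorus X) (e' : D.Emb X T') (e₁' : D.Iso1 X) (e₂' : D.Iso2 X),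
      D.IsStarHom e → D.IsStarHom e' →
        ((D.IsStConj (D.gamma0Of S.base T e) (D.gamma0Of X T' e') ∧
            D.IsConjAfp (D.gammaOf S.base e₁) (D.gammaOf X e₁') ∧
            D.IsSigmaConj (D.deltaOf S.base e₂) (D.deltaOf X e₂')) ↔
          ∃ h : S.IsQbarIsogBase (S.ofPol X), S.coh (S.ofPol X) h ∈ S.kerOne)

end IsogenyClassData

end Literature.NumberTheory.Kottwitz1992.IsogenyClasses
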